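import Summits.ABC.StewartYu.GenThreeVanishingShift
import Summits.ABC.StewartYu.GenThreeVanishingRat
import Summits.ABC.StewartYu.ObstructionRankLe
import HarnessLib

/-!
# Gen-3 engines ⇒ the zero estimate, VII: the END call for rational generators (both frames)

`Summits/ABC/StewartYu/GenThreeEndRat.lean` — cell `abc-stewartyu` (route `PadicPrimesKummerThird`, cruxes
`Y07Odd` stmt-ABC-19658 / `Y07Two` stmt-ABC-19659), seat p3 (g4), F-two lead; brick (d) of HOME/p3/memo-08 §5.
Theorems only — a composition of the landed V package for the data the engine texts actually carry.

The engine texts quantify over nonzero rational generators `α : Fin m → ℚ`, multiplicatively independent,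
and an exponent vector `b ≠ 0`.  `exists_obstruction_rat` is the frame's LAST LINE before the Matveev
alternative: from the Laurent presentation of its auxiliary function and the identities (5.4) at the points
`(x, α^x)`, `|x| ≤ (m+1)X`, it returns the obstruction subgroup of `Nesterenko2003_prop51` (taken as the
hypothesis `hZ`, exactly as the registered stubs `stub_engineOdd`/`stub_engineTwo` take it) WITH the orbit
count `Card((Σ_X·H)/H) = 2X+1` already substituted and `r ≤ m`, `addDim ≤ 1` made explicit — i.e. the
input of `NesterenkoZeroEnd` (p4) / of `MatveevStepData.exists_matveev_step_data` (p3).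
-/

noncomputable section

open Finset
open Literature.NumberTheory.Transcendental
open Literature.NumberTheory.Transcendental.GaGm

namespace Summit.ABC.StewartYu.GenThreeVanishing

variable {m : ℕ}

/-- `addDim ≤ 1` for every connected algebraic subgroup (the `𝔾ₐ`-part is `0` or `ℂ`). [folklore] -/
theorem addDim_le_one (H : ConnAlgSubgroup m) : H.addDim ≤ 1 := by
  unfold ConnAlgSubgroup.addDim; split <;> omega

/-- **The END call for rational generators.**  Data: `α : Fin m → ℚ` nonzero and multiplicatively
independent, `b : Fin m → ℤ` with a pivot `b j₀ ≠ 0`, the subspace `W` on which `∑ bⱼ ηⱼ = 0`, a Laurent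
presentation `(aᵢ, κᵢ, qᵢ)_{i ∈ I}` of the auxiliary function with `aᵢ ≤ D₀`, `|κᵢⱼ| ≤ Dⱼ`, distinct
exponents and one nonzero coefficient, the identities (5.4) for `|x| ≤ (m+1)X`, `t + ∑νₖ ≤ (m+1)S₀`,
`ν_{j₀} = 0`, and the zero estimate `hZ`.  Conclusion: `H, r, M` with `r ≤ m`, `H.addDim ≤ 1`, rows of `M`
independent, `H.chars = closure(rows M)`, and
`binom(S₀+ℓ₀, ℓ₀) · (2X+1) · 𝓗(H; D₀, D) ≤ (m+1)! 2^m D₀ ∏ Dⱼ`. [cite: Nesterenko2003, §5.2 (5.13)] -/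
theorem exists_obstruction_rat (hZ : Nesterenko2003_prop51)
    (α : Fin m → ℚ) (hα : ∀ j, α j ≠ 0) (hind : ∀ μ : Fin m → ℤ, ∏ j, α j ^ μ j = 1 → μ = 0)
    (b : Fin m → ℤ) (j₀ : Fin m) (hb : b j₀ ≠ 0)
    (W : Submodule ℂ (ℂ × (Fin m → ℂ))) (hWb : ∀ u ∈ W, ∑ j, (b j : ℂ) * u.2 j = 0)
    {ι : Type*} (I : Finset ι) (a : ι → ℕ) (κ : ι → Fin m → ℤ) (q : ι → ℂ)
    (D₀ S₀ X : ℕ) (D : Fin m → ℕ)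
    (ha : ∀ i ∈ I, a i ≤ D₀) (hκ : ∀ i ∈ I, ∀ j, |κ i j| ≤ (D j : ℤ))
    (hinj : Set.InjOn (fun i => (a i, κ i)) I) {i₀ : ι} (hi₀ : i₀ ∈ I) (hq : q i₀ ≠ 0)
    (hL : ∀ x : ℤ, |x| ≤ (((m + 1) * X : ℕ) : ℤ) → ∀ (t : ℕ) (ν : Fin m → ℕ), ν j₀ = 0 →
      t + ∑ k, ν k ≤ (m + 1) * S₀ →
      ∑ i ∈ I, q i * (((a i).descFactorial t : ℕ) : ℂ) * ((x : ℂ) * 1) ^ (a i - t) *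
        (∏ k, ((b j₀ : ℂ) * (κ i k : ℂ) - (b k : ℂ) * (κ i j₀ : ℂ)) ^ ν k) *
        ∏ j, ((α j : ℂ)) ^ (x * κ i j) = 0) :
    ∃ (H : ConnAlgSubgroup m) (r : ℕ) (M : Matrix (Fin r) (Fin m) ℤ),
      r ≤ m ∧ H.addDim ≤ 1 ∧
      LinearIndependent ℤ (fun i => M i) ∧
      H.chars = AddSubgroup.closure (Set.range fun i => M i) ∧
      H.addDim + (m - r) ≤ m ∧
      Nat.choose (S₀ + (Module.finrank ℂ W - Module.finrank ℂ ↥(W ⊓ H.tangent)))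
          (Module.finrank ℂ W - Module.finrank ℂ ↥(W ⊓ H.tangent)) * (2 * X + 1) *
        nesterenkoH m r H.addDim M D₀ D ≤ (m + 1).factorial * 2 ^ m * D₀ * ∏ j, D j := by
  -- the complex units
  set ξ : Fin m → ℂˣ := fun j => Units.mk0 ((α j : ℂ)) (by exact_mod_cast hα j) with hξ
  have hξval : ∀ j, ((ξ j : ℂˣ) : ℂ) = (α j : ℂ) := fun j => rfl
  have hindξ : ∀ φ : Fin m → ℤ, ∏ j, ξ j ^ φ j = 1 → φ = 0 := hind_units_of_rat α hα hind
  have hL' : ∀ x : ℤ, |x| ≤ (((m + 1) * X : ℕ) : ℤ) → ∀ (t : ℕ) (ν : Fin m → ℕ), ν j₀ = 0 →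
      t + ∑ k, ν k ≤ (m + 1) * S₀ →
      ∑ i ∈ I, q i * (((a i).descFactorial t : ℕ) : ℂ) * ((x : ℂ) * 1) ^ (a i - t) *
        (∏ k, ((b j₀ : ℂ) * (κ i k : ℂ) - (b k : ℂ) * (κ i j₀ : ℂ)) ^ ν k) *
        ∏ j, ((ξ j : ℂ)) ^ (x * κ i j) = 0 := by
    intro x hx t ν hν hT
    have h := hL x hx t ν hν hT
    simpa only [hξval] using h
  obtain ⟨H, r, M, hM, hchars, hdim, hineq⟩ :=
    exists_obstruction_of_laurentIdentities hZ (fun j => (b j : ℂ)) j₀ (by exact_mod_cast hb) W hWb 1 ξ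
      I a κ q D₀ S₀ X D ha hκ hinj hi₀ hq hL'
  have hcount := ncard_image_mk_zpowSet (m := m) 1 one_ne_zero ξ hindξ H r M hM hchars hdim X
  refine ⟨H, r, M, Summit.ABC.StewartYu.MatveevStepData.rank_le_of_linearIndependent_int_rows M hM,
    addDim_le_one H, hM, hchars, hdim, ?_⟩
  rw [hcount] at hineq
  exact hineq

end Summit.ABC.StewartYu.GenThreeVanishing

end
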